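import Summits.HodgeConjecture.HodgeConjecture.Theorems.HeckePrymWeilWeilDescendingUpward
import Summits.HodgeConjecture.HodgeConjecture.Theorems.HeckePrymWeilProductDescentTransfer
import Literature.AlgebraicGeometry.HodgeTheory.ComplexConjugationHolds
import Literature.AlgebraicGeometry.HodgeTheory.AlgebraicClassesCupAbelianVariety
import Literature.AlgebraicGeometry.HodgeTheory.HodgeTypePullback
import Literature.AlgebraicGeometry.HodgeTheory.CupPreservesHodgeTypeOfDeRham
import Literature.AlgebraicGeometry.HodgeTheory.HodgeFiltrationModelsReductionProofs
import Literature.AlgebraicGeometry.Motives.ComplexPointsOrientation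

/-!
# `ProductDescent` (stmt-HodgeConjecture-14498) · III · one named fact (multiplicative de Rham)

Route `HeckePrymWeil`, support item `ProductDescent` — the downward half of Schoen's product step
(C. Schoen, Compositio Math. 114 (1998), §10, Proposition and proof, pp. 332–333; E. Markman,
arXiv:2509.23403 §11.5 Step 2; K. Koike, doi:10.4153/cmb-2004-055-x).

File II (`HeckePrymWeilProductDescent`) proves the route decl GRANTED four named facts. Since then
the first of them, `nonempty_hodgeModel` (smooth projective complex varieties have Hodge models:
Serre's analytification, de Rham's theorem in its natural form, the Hodge decomposition of compact
Kähler manifolds), has become the THEOREM `nonempty_hodgeModel_holds` of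
`Literature/…/ComplexConjugationHolds`. This file records what is left:

* `productDescent_of_deRham` — the route decl `Theses.HeckePrymWeil.ProductDescent` AS FILED from
  THREE named facts (superseding file II's `productDescent_of`): de Rham's theorem in its MULTIPLICATIVE form
  (`Literature.NumberTheory.Transcendental.exists_deRhamIsoFamily 𝓘(ℝ, E)`, used once, for the Hodge
  bidegree `(n+1,n+1)` of `pr_A^* w ∪ pr_B^* b` on `A × B` — the same single use as in the tree's
  `middleDimensionReduction_of_multiplicative_deRham`), Lefschetz `(1,1)` (`lefschetzOneOne_rational`)
  and the Hodge index theorem for surfaces (`hodgeIndex_surface`), the last two only to turn the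
  rational `(1,1)` Weil-plane class `b` of the ABSTRACT partner surface into an algebraic divisor
  class `t` with `b± ∪ t ≠ 0`.
* `cupProduct_eigencomponents_ne_zero` — if `b = b₊ + b₋` is rational with `g^* b₊ = α b₊`,
  `g^* b₋ = ᾱ b₋`, `α ≠ ᾱ`, and `t` is rational with `b ∪ t ≠ 0`, then `b₊ ∪ t ≠ 0` and `b₋ ∪ t ≠ 0`
  (`b₋ ∪ t = conj (b₊ ∪ t)`); fact-free.
* `productDescentAt_of_deRham` — the LEMMA form for one Weil pair `(A, φ)` and a GIVEN partner
  `(B, ψ, b, t)` (`t` a rational ALGEBRAIC class on `B` with `b ∪ t ≠ 0`): from the multiplicative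
  de Rham theorem ALONE — Lefschetz `(1,1)` and Hodge index disappear, and neither `φ∘φ = -p` nor
  the primality of `p` is used (only `p ≥ 4`);
* `productDescent_transferReady_of_deRham` — the TRANSFER-READY form of the item, in which the
  partner clause `∃ b` of the hypothesis also supplies such a `t` (as every intended witness
  `B = E × E'` does, with `t` a graph/fibre divisor), all other clauses VERBATIM. This is the
  restatement offered to the planner (release note of the item): with it `ProductDescent` carries
  exactly the one named fact that every rung-to-rung step through a product (`WeilDescending`,
  BFNP Lemma 48 `middleDimensionReduction`) carries in this tree.

Proof of the lemma: Schoen §10 verbatim as in file II — `w = w₊ + w₋`, `b = b₊ + b₋`; the rational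
Weil projector makes `pr_A^* w± ∪ pr_B^* b±` algebraic on `A × B` (upward half,
`weilEigencomponents_mem_algebraicClasses_of_rung`, fed the Hodge type of `pr_A^* w ∪ pr_B^* b`
certified by `nonempty_hodgeModel_holds`, `hodgePQ_independent_of_hodgeModel_holds` and the
multiplicative de Rham family); `(pr_A^* w± ∪ pr_B^* b±) ∪ pr_B^* t` is algebraic (moving divisors by
translations, `AbelianVariety.cupProduct_mem_algebraicClasses_one`); its Gysin image along `pr_A`
(the tree's real `complexGysin μ`) is algebraic and equals `ε± • w±` with
`ε± • 1 = pr_{A*} pr_B^*(b± ∪ t) ≠ 0` (`complexGysin_fst_map_snd_ne_zero`,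
`mem_algebraicClasses_of_complexGysin_fst_cupProduct`).
-/

noncomputable section

-- every declaration of this problem lives in `Summit.HodgeConjecture.HodgeConjecture.…` (summit = sub-problem)
set_option linter.dupNamespace false

open scoped Manifold
open CategoryTheory MonoidalCategory CartesianMonoidalCategory
open Literature.AlgebraicGeometry Literature.AlgebraicGeometry.HodgeTheory
open Literature.AlgebraicTopology.SingularHomology
open Summit.HodgeConjecture.HodgeConjecture.Theorems.WeilTwelvefoldsSqrtMinus7.Negative
  (one_add_I_sqrt_pow_ne)

namespace Summit.HodgeConjecture.HodgeConjecture.Theorems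

/-- `conj (1 + i√p) = 1 - i√p` (`√p` is real). -/
private theorem conj_sp (p : ℕ) :
    starRingEnd ℂ (1 + Complex.I * (Real.sqrt (p : ℝ) : ℂ)) = 1 - Complex.I * (Real.sqrt (p : ℝ) : ℂ) := by
  rw [map_add, map_one, map_mul, Complex.conj_I, Complex.conj_ofReal, neg_mul, sub_eq_add_neg]

/-- **Both eigencomponents of a real class pair non-trivially with a real partner.** Let
`g : Y → Y` be a morphism of `ℂ`-schemes, `b = b₊ + b₋` a RATIONAL class in `H²(Y(ℂ); ℂ)` with
`g^* b₊ = α b₊`, `g^* b₋ = ᾱ b₋`, `α ≠ ᾱ`, and `t` a RATIONAL class with `b ∪ t ≠ 0` in `H⁴`. Then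
`b₊ ∪ t ≠ 0` and `b₋ ∪ t ≠ 0`: `conj b₊ = b₋` (`conjClass_eigencomponent_eq`), conjugation is
multiplicative (`conjClass_cupProduct`) and fixes the rational `t`, so `b₋ ∪ t = conj (b₊ ∪ t)` and
the two summands of `b ∪ t = b₊ ∪ t + b₋ ∪ t ≠ 0` vanish together. (The tail of file I's
`exists_algebraic_partner_of_hodgeIndex`, with the partner GIVEN instead of produced by Hodge index
and Lefschetz `(1,1)`; Schoen §10: "`W_{A'}` is generated by cohomology classes of divisors".) -/
theorem cupProduct_eigencomponents_ne_zero {Y : Motives.SchemeOver ℂ} (g : Y ⟶ Y) {α : ℂ}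
    (hα : α ≠ starRingEnd ℂ α) {bp bm t : complexBetti Y 2}
    (hbp : complexBetti.map g 2 bp = α • bp) (hbm : complexBetti.map g 2 bm = starRingEnd ℂ α • bm)
    (hr : IsRationalClass (bp + bm)) (ht : IsRationalClass t)
    (hbt : cupProduct two_add_two (bp + bm) t ≠ 0) :
    cupProduct two_add_two bp t ≠ 0 ∧ cupProduct two_add_two bm t ≠ 0 := by
  have hconj : conjClass (Motives.ComplexPoints Y) 2 bp = bm :=
    conjClass_eigencomponent_eq (Motives.AlgPoints.mapContinuous (L := ℂ) g) hα hbp hbm hr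
  have hm : cupProduct two_add_two bm t =
      conjClass (Motives.ComplexPoints Y) 4 (cupProduct two_add_two bp t) := by
    rw [conjClass_cupProduct, hconj, ht.conjClass_eq]
  have hp : cupProduct two_add_two bp t ≠ 0 := by
    intro h
    apply hbt
    rw [map_add, LinearMap.add_apply, hm, h, conjClass_zero, add_zero]
  refine ⟨hp, ?_⟩
  rw [hm]
  intro h
  apply hp
  rw [← conjClass_conjClass (cupProduct two_add_two bp t), h, conjClass_zero]

/-- **Schoen's product step, downward half, for ONE Weil pair and a GIVEN partner** (the lemma
form of `ProductDescent`, transfer-ready; from the multiplicative de Rham theorem alone). Let `p ≥ 4`,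
`n ≥ 1`, `(A, φ)` an abelian `2n`-fold and `(B, ψ)` an abelian surface with endomorphisms, `b` a
rational `(1,1)` class of `B` in the Weil plane `Eig((𝟙+ψ)^*, (1+i√p)²) ⊔ Eig((𝟙+ψ)^*, (1-i√p)²)`,
`t` a rational ALGEBRAIC class of `B` with `b ∪ t ≠ 0`, and assume every rational `(n+1,n+1)` class
of `A × B` in the Weil plane of `(𝟙 + φ × ψ)^*` is algebraic. Then every rational `(n,n)` class `c`
of `A` in the Weil plane of `(𝟙+φ)^*` is algebraic. (Neither `φ∘φ = -p` nor `ψ∘ψ = -p` nor the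
primality of `p` is used: only the separation `(1+i√p)^k ≠ (1-i√p)^k`, `k ≥ 1`, `p ≥ 4`.) Proof:
Schoen 1998 §10 / Markman arXiv:2509.23403 §11.5 Step 2 on the tree's carriers — module
docstring; the Hodge bidegree `(n+1,n+1)` of `pr_A^* c ∪ pr_B^* b` is where de Rham's theorem in
multiplicative form (`exists_deRhamIsoFamily`) enters, Hodge models and independence of `H^{p,q}`
being the theorems `nonempty_hodgeModel_holds`, `hodgePQ_independent_of_hodgeModel_holds`. -/
theorem productDescentAt_of_deRham
    (hdR : ∀ (E : Type) [NormedAddCommGroup E] [NormedSpace ℂ E] [FiniteDimensional ℂ E],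
      Literature.NumberTheory.Transcendental.exists_deRhamIsoFamily 𝓘(ℝ, E))
    {p : ℕ} (hp4 : 4 ≤ p) {n : ℕ} (hn : 1 ≤ n) {A : Motives.AbelianVariety ℂ} (φ : A ⟶ A)
    (hAdim : A.dim = 2 * n) {B : Motives.AbelianVariety ℂ} (ψ : B ⟶ B) (hBdim : B.dim = 2)
    {b t : complexBetti B.X (2 * 1)} (hbr : IsRationalClass b)
    (hbH : IsOfHodgeType (2 * 1) B.X (2 * 1) 1 1 b)
    (hbW : b ∈ Module.End.eigenspace (complexBetti.map (𝟙 B + ψ).hom.hom.hom (2 * 1)).hom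
          ((1 + Complex.I * (Real.sqrt (p : ℝ) : ℂ)) ^ (2 * 1)) ⊔
        Module.End.eigenspace (complexBetti.map (𝟙 B + ψ).hom.hom.hom (2 * 1)).hom
          ((1 - Complex.I * (Real.sqrt (p : ℝ) : ℂ)) ^ (2 * 1)))
    (htr : IsRationalClass t) (htalg : t ∈ algebraicClasses B.X 1)
    (hbt : cupProduct (show 2 * 1 + 2 * 1 = 2 * (2 * 1) from rfl) b t ≠ 0)
    (halgAB : ∀ c : complexBetti (A.prod B).X (2 * (n + 1)), IsRationalClass c →
      IsOfHodgeType (2 * (n + 1)) (A.prod B).X (2 * (n + 1)) (n + 1) (n + 1) c →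
      c ∈ Module.End.eigenspace (complexBetti.map (𝟙 (A.prod B) +
              Motives.AbelianVariety.prodLift (Motives.AbelianVariety.fst A B ≫ φ)
                (Motives.AbelianVariety.snd A B ≫ ψ)).hom.hom.hom (2 * (n + 1))).hom
            ((1 + Complex.I * (Real.sqrt (p : ℝ) : ℂ)) ^ (2 * (n + 1))) ⊔
          Module.End.eigenspace (complexBetti.map (𝟙 (A.prod B) +
              Motives.AbelianVariety.prodLift (Motives.AbelianVariety.fst A B ≫ φ)
                (Motives.AbelianVariety.snd A B ≫ ψ)).hom.hom.hom (2 * (n + 1))).hom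
            ((1 - Complex.I * (Real.sqrt (p : ℝ) : ℂ)) ^ (2 * (n + 1))) →
      c ∈ algebraicClasses (A.prod B).X (n + 1))
    {c : complexBetti A.X (2 * n)} (hc : IsRationalClass c)
    (hcH : IsOfHodgeType (2 * n) A.X (2 * n) n n c)
    (hcW : c ∈ Module.End.eigenspace (complexBetti.map (𝟙 A + φ).hom.hom.hom (2 * n)).hom
          ((1 + Complex.I * (Real.sqrt (p : ℝ) : ℂ)) ^ (2 * n)) ⊔
        Module.End.eigenspace (complexBetti.map (𝟙 A + φ).hom.hom.hom (2 * n)).hom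
          ((1 - Complex.I * (Real.sqrt (p : ℝ) : ℂ)) ^ (2 * n))) :
    c ∈ algebraicClasses A.X n := by
  -- smoothness witnesses and the orientation family
  have hA : Motives.IsSmoothProjective (2 * n) A.X := isSmoothProjective_of_dim_eq hAdim
  have hB : Motives.IsSmoothProjective (2 * 1) B.X := isSmoothProjective_of_dim_eq hBdim
  have hAB : Motives.IsSmoothProjective (2 * (n + 1)) (A.prod B).X := isSmoothProjective_prod_two_mul hA hB
  have hABt : Motives.IsSmoothProjective (2 * n + 2 * 1) (A.prod B).X :=
    Motives.IsSmoothProjective.tensor_holds hA hB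
  let μ : OrientationFamily := fun _ _ h ↦ Classical.choice (Motives.ComplexPoints.isOrientableOver ℂ h)
  -- shorthands for the two eigenvalues
  set sp : ℂ := 1 + Complex.I * (Real.sqrt (p : ℝ) : ℂ) with hsp
  set sm : ℂ := 1 - Complex.I * (Real.sqrt (p : ℝ) : ℂ) with hsm
  have hconj : starRingEnd ℂ sp = sm := conj_sp p
  -- `c = c₊ + c₋`, `b = b₊ + b₋`
  obtain ⟨cp, hcp, cm, hcm, rfl⟩ := Submodule.mem_sup.1 hcW
  obtain ⟨bp, hbp, bm, hbm, rfl⟩ := Submodule.mem_sup.1 hbW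
  rw [Module.End.mem_eigenspace_iff] at hcp hcm hbp hbm
  -- the compatible endomorphism `Φ = φ × ψ`
  set Φ : A.prod B ⟶ A.prod B := Motives.AbelianVariety.prodLift (Motives.AbelianVariety.fst A B ≫ φ)
    (Motives.AbelianVariety.snd A B ≫ ψ) with hΦ
  have h₁ : Φ ≫ Motives.AbelianVariety.fst A B = Motives.AbelianVariety.fst A B ≫ φ :=
    Motives.AbelianVariety.prodLift_fst _ _
  have h₂ : Φ ≫ Motives.AbelianVariety.snd A B = Motives.AbelianVariety.snd A B ≫ ψ :=
    Motives.AbelianVariety.prodLift_snd _ _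
  -- Hodge type `(n+1, n+1)` of `P = pr_A^* c ∪ pr_B^* b`: Hodge models and independence are theorems,
  -- the bidegree of the cup product is the multiplicative de Rham theorem
  have hI := hodgePQ_independent_of_hodgeModel_holds
  have hfst : PreservesHodgeType (2 * n + 2 * 1) (2 * n) (Motives.AbelianVariety.fst A B).hom.hom.hom :=
    preservesHodgeType_of_nonempty_hodgeModel hI nonempty_hodgeModel_holds hABt hA _
  have hsnd : PreservesHodgeType (2 * n + 2 * 1) (2 * 1) (Motives.AbelianVariety.snd A B).hom.hom.hom :=
    preservesHodgeType_of_nonempty_hodgeModel hI nonempty_hodgeModel_holds hABt hB _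
  have hcupH : CupPreservesHodgeType (2 * n + 2 * 1) (A.prod B).X :=
    cupPreservesHodgeType_of_nonempty_hodgeModel hI nonempty_hodgeModel_holds hdR hABt
  have h : 2 * n + 2 * 1 = 2 * (n + 1) := by ring
  have hH : IsOfHodgeType (2 * (n + 1)) (A.prod B).X (2 * (n + 1)) (n + 1) (n + 1)
      (cupProduct h (complexBetti.map (Motives.AbelianVariety.fst A B).hom.hom.hom (2 * n) (cp + cm))
        (complexBetti.map (Motives.AbelianVariety.snd A B).hom.hom.hom (2 * 1) (bp + bm))) :=
    isOfHodgeType_cupProduct_map_fst_map_snd h hfst hsnd hcupH hcH hbH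
  -- upward half: `pr_A^* c± ∪ pr_B^* b±` are algebraic on `A × B`
  obtain ⟨hP, hMm⟩ := weilEigencomponents_mem_algebraicClasses_of_rung h₁ h₂ hp4 hn h hAB halgAB
    hcp hcm hbp hbm hc hbr hH
  -- the partner class `t`: `b± ∪ t ≠ 0`
  have hx₂ : sp ^ (2 * 1) ≠ sm ^ (2 * 1) := one_add_I_sqrt_pow_ne p hp4 (2 * 1) (by omega)
  have hα : sp ^ (2 * 1) ≠ starRingEnd ℂ (sp ^ (2 * 1)) := by rwa [map_pow, hconj]
  have hbm' : complexBetti.map (𝟙 B + ψ).hom.hom.hom 2 bm = starRingEnd ℂ (sp ^ (2 * 1)) • bm := by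
    rw [map_pow, hconj]; exact hbm
  have hbt' : cupProduct two_add_two (bp + bm) t ≠ 0 := hbt
  obtain ⟨hpt, hmt⟩ := cupProduct_eigencomponents_ne_zero (𝟙 B + ψ).hom.hom.hom hα hbp hbm' hbr htr hbt'
  -- `pr_B^* t` is algebraic on `A × B`, hence so are `(pr_A^* c± ∪ pr_B^* b±) ∪ pr_B^* t`
  have ht' : complexBetti.map (Motives.AbelianVariety.snd A B).hom.hom.hom (2 * 1) t ∈
      algebraicClasses (A.prod B).X 1 :=
    map_snd_mem_supportedClasses hA hB htalg
  have halgp := AbelianVariety.cupProduct_mem_algebraicClasses_one (A.prod B) hP ht'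
  have halgm := AbelianVariety.cupProduct_mem_algebraicClasses_one (A.prod B) hMm ht'
  -- the fibre integrals `pr_{A*} pr_B^*(b± ∪ t) ≠ 0`
  have hjj' : 2 * 1 + 2 * 1 = 2 * (2 * 1) := rfl
  have hpt' : cupProduct hjj' bp t ≠ 0 := hpt
  have hmt' : cupProduct hjj' bm t ≠ 0 := hmt
  have hnep := complexGysin_fst_map_snd_ne_zero μ hA hB hpt'
  have hnem := complexGysin_fst_map_snd_ne_zero μ hA hB hmt'
  -- Schoen's transfer, component by component
  refine Submodule.add_mem _ ?_ ?_
  · exact mem_algebraicClasses_of_complexGysin_fst_cupProduct μ hA hB (l := n) (j := 2 * 1)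
      (j' := 2 * 1) (s := 2 * (n + 1)) h hjj' hnep halgp
  · exact mem_algebraicClasses_of_complexGysin_fst_cupProduct μ hA hB (l := n) (j := 2 * 1)
      (j' := 2 * 1) (s := 2 * (n + 1)) h hjj' hnem halgm

/-- **`ProductDescent`, transfer-ready form, from the multiplicative de Rham theorem alone.** For a
prime `p ≡ 3 (4)`, `p ≥ 7` and `n ≥ 1`: IF every abelian `2n`-fold `(A, φ)` with `φ∘φ = -p` has a
partner Weil surface `(B, ψ)` — `dim B = 2`, `ψ∘ψ = -p`, a non-zero rational `(1,1)` class `b` in its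
Weil plane TOGETHER WITH a rational algebraic class `t` on `B` with `b ∪ t ≠ 0` — such that every
rational `(n+1,n+1)` Weil class of `(A × B, φ × ψ)` is algebraic, THEN every rational `(n,n)` Weil
class of every such `(A, φ)` is algebraic. Compared with the route decl
`Theses.HeckePrymWeil.ProductDescent` (item stmt-HodgeConjecture-14498) only the clause `∃ b` is
strengthened to `∃ b t` (three extra conjuncts `IsRationalClass t`, `t ∈ algebraicClasses B.X 1`,
`b ∪ t ≠ 0`, as every intended witness `B = E × E'` supplies with a graph or fibre divisor);
the hypothesis on `A × B` and the conclusion are VERBATIM. This is the restatement offered to the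
planner: GRANTED de Rham's theorem in multiplicative form (`exists_deRhamIsoFamily`) it holds by
`productDescentAt_of_deRham` (Schoen 1998 §10, Proposition; Markman arXiv:2509.23403 §11.5 Step 2;
Koike 2004 Thm. 2.1), with no Lefschetz `(1,1)` and no Hodge index. -/
theorem productDescent_transferReady_of_deRham
    (hdR : ∀ (E : Type) [NormedAddCommGroup E] [NormedSpace ℂ E] [FiniteDimensional ℂ E],
      Literature.NumberTheory.Transcendental.exists_deRhamIsoFamily 𝓘(ℝ, E)) :
    ∀ p : ℕ, p.Prime → p % 4 = 3 → 7 ≤ p → ∀ n : ℕ, 1 ≤ n →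
      (∀ (A : Motives.AbelianVariety ℂ) (φ : A ⟶ A), A.dim = 2 * n → φ ≫ φ = -((p : ℤ) • 𝟙 A) →
        ∃ (B : Motives.AbelianVariety ℂ) (ψ : B ⟶ B), B.dim = 2 ∧ ψ ≫ ψ = -((p : ℤ) • 𝟙 B) ∧
          (∃ b t : complexBetti B.X (2 * 1), b ≠ 0 ∧ IsRationalClass b ∧
            IsOfHodgeType (2 * 1) B.X (2 * 1) 1 1 b ∧
            b ∈ Module.End.eigenspace (complexBetti.map (𝟙 B + ψ).hom.hom.hom (2 * 1)).hom
                  ((1 + Complex.I * (Real.sqrt (p : ℝ) : ℂ)) ^ (2 * 1)) ⊔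
                Module.End.eigenspace (complexBetti.map (𝟙 B + ψ).hom.hom.hom (2 * 1)).hom
                  ((1 - Complex.I * (Real.sqrt (p : ℝ) : ℂ)) ^ (2 * 1)) ∧
            IsRationalClass t ∧ t ∈ algebraicClasses B.X 1 ∧
            cupProduct (show 2 * 1 + 2 * 1 = 2 * (2 * 1) from rfl) b t ≠ 0) ∧
          ∀ c : complexBetti (A.prod B).X (2 * (n + 1)), IsRationalClass c →
            IsOfHodgeType (2 * (n + 1)) (A.prod B).X (2 * (n + 1)) (n + 1) (n + 1) c →
            c ∈ Module.End.eigenspace (complexBetti.map (𝟙 (A.prod B) +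
                    Motives.AbelianVariety.prodLift (Motives.AbelianVariety.fst A B ≫ φ)
                      (Motives.AbelianVariety.snd A B ≫ ψ)).hom.hom.hom (2 * (n + 1))).hom
                  ((1 + Complex.I * (Real.sqrt (p : ℝ) : ℂ)) ^ (2 * (n + 1))) ⊔
                Module.End.eigenspace (complexBetti.map (𝟙 (A.prod B) +
                    Motives.AbelianVariety.prodLift (Motives.AbelianVariety.fst A B ≫ φ)
                      (Motives.AbelianVariety.snd A B ≫ ψ)).hom.hom.hom (2 * (n + 1))).hom
                  ((1 - Complex.I * (Real.sqrt (p : ℝ) : ℂ)) ^ (2 * (n + 1))) →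
            c ∈ algebraicClasses (A.prod B).X (n + 1)) →
      ∀ (A : Motives.AbelianVariety ℂ) (φ : A ⟶ A), A.dim = 2 * n → φ ≫ φ = -((p : ℤ) • 𝟙 A) →
        ∀ c : complexBetti A.X (2 * n), IsRationalClass c → IsOfHodgeType (2 * n) A.X (2 * n) n n c →
          c ∈ Module.End.eigenspace (complexBetti.map (𝟙 A + φ).hom.hom.hom (2 * n)).hom
                ((1 + Complex.I * (Real.sqrt (p : ℝ) : ℂ)) ^ (2 * n)) ⊔
              Module.End.eigenspace (complexBetti.map (𝟙 A + φ).hom.hom.hom (2 * n)).hom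
                ((1 - Complex.I * (Real.sqrt (p : ℝ) : ℂ)) ^ (2 * n)) →
          c ∈ algebraicClasses A.X n := by
  intro p _ _ hp7 n hn hyp A φ hAdim hφ c hc hcH hcW
  obtain ⟨B, ψ, hBdim, -, ⟨b, t, -, hbr, hbH, hbW, htr, htalg, hbt⟩, halgAB⟩ := hyp A φ hAdim hφ
  exact productDescentAt_of_deRham hdR (by omega) hn φ hAdim ψ hBdim hbr hbH hbW htr htalg hbt halgAB
    hc hcH hcW

/-- **`ProductDescent` AS FILED (route decl, item stmt-HodgeConjecture-14498), from three named
facts**: de Rham's theorem in multiplicative form (`exists_deRhamIsoFamily`), Lefschetz `(1,1)`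
(`lefschetzOneOne_rational`) and the Hodge index theorem for surfaces (`hodgeIndex_surface`). The
last two manufacture the partner of the lemma: the rational `(1,1)` class `b ≠ 0` of the abstract
partner surface pairs non-trivially with some rational algebraic divisor class `t`
(`exists_cup_ne_zero_of_hodgeIndex`: non-degeneracy of the intersection form on `NS(B)_ℚ ∋ b`,
Schoen's "`W_{A'}` is generated by cohomology classes of divisors"); then `productDescentAt_of_deRham`.
This supersedes file II's `productDescent_of`, whose fourth fact `nonempty_hodgeModel` is now the
theorem `nonempty_hodgeModel_holds`. Schoen 1998 §10, Proposition; Markman arXiv:2509.23403 §11.5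
Step 2; Koike 2004 Thm. 2.1. -/
theorem productDescent_of_deRham
    (hdR : ∀ (E : Type) [NormedAddCommGroup E] [NormedSpace ℂ E] [FiniteDimensional ℂ E],
      Literature.NumberTheory.Transcendental.exists_deRhamIsoFamily 𝓘(ℝ, E))
    (hL : lefschetzOneOne_rational) (hHI : ∀ X : Motives.SchemeOver ℂ, hodgeIndex_surface X) :
    Theses.HeckePrymWeil.ProductDescent := by
  intro p _ _ hp7 n hn hyp A φ hAdim hφ c hc hcH hcW
  obtain ⟨B, ψ, hBdim, -, ⟨b, hb0, hbr, hbH, hbW⟩, halgAB⟩ := hyp A φ hAdim hφ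
  have hB : Motives.IsSmoothProjective 2 B.X := isSmoothProjective_of_dim_eq hBdim
  obtain ⟨t, htr, -, htalg, hbt⟩ := exists_cup_ne_zero_of_hodgeIndex (hHI B.X) hL hB b hbr hbH hb0
  have hbt' : cupProduct (show 2 * 1 + 2 * 1 = 2 * (2 * 1) from rfl) b t ≠ 0 := hbt
  exact productDescentAt_of_deRham hdR (by omega) hn φ hAdim ψ hBdim hbr hbH hbW htr htalg hbt' halgAB
    hc hcH hcW

end Summit.HodgeConjecture.HodgeConjecture.Theorems

end
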